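import Summits.Ventures.HSemireg.PorteousShapes
import Mathlib.RingTheory.RegularLocalRing.Defs
import Mathlib.RingTheory.Nakayama
import Mathlib.RingTheory.LocalRing.RingHom.Basic
import Mathlib.RingTheory.PowerSeries.Inverse
import Mathlib.RingTheory.KrullDimension.NonZeroDivisors
import Mathlib.RingTheory.KrullDimension.PID

/-!
# Venture HSemireg — SHAPE LEMMA, local algebra (ii) completed in the kernel:
# an ideal inside `m²` does not lower the embedding dimension, so a proper quotient is never regular

HONEST FRAMING.  Part of the Lean side of the computation cell `pub-hsemireg` (track «S4-PUSH» (ii), lane pen s4-prove-1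
g6, note `run/shared/lean/pub/pub-hsemireg/s4push/prove-1/ATTEMPT-7.md`).  `PorteousShapes.lean` §2 proves that at a
point `p` of `D_{k−1}(φ)` every `(k+1)`-minor of `φ` lies in `m_p²` (`minor_succ_det_mem_sq`) and leaves the next step —
«`I_{Z,p} ⊆ m_p²` and `dim_p Z < dim A` ⇒ `Z` is not smooth at `p`» (Zariski tangent space) — on PAPER.  This file
kernel-checks that step in Mathlib's language of regular local rings (`IsRegularLocalRing`: a Noetherian local ring
whose maximal ideal is generated by `dim` elements):

* `spanFinrank_maximalIdeal_quotient_eq_of_le_sq` — for a Noetherian local ring `R` and an ideal `I ≤ m²`, the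
  maximal ideals of `R` and of `R ⧸ I` need the SAME minimal number of generators (Nakayama); equivalently
  (`finrank_cotangentSpace_quotient_eq_of_le_sq`) the cotangent spaces `m/m²` have the same dimension — the Zariski
  tangent space of `Spec (R ⧸ I)` at the closed point is all of that of `Spec R`.
* `ringKrullDim_le_of_isRegularLocalRing_quotient` — hence if `R ⧸ I` is regular then `dim R ≤ dim (R ⧸ I)`
  (Krull: `dim R ≤` number of generators of `m`); contrapositively `not_isRegularLocalRing_quotient_of_le_sq`:
  `I ≤ m²` and `dim (R ⧸ I) < dim R` ⇒ `R ⧸ I` is NOT a regular local ring.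
* `minorSpan_le_sq` / `not_isRegularLocalRing_quotient_minorSpan` — composed with `minor_succ_det_mem_sq`: over a
  Noetherian local `K`-algebra `A` (= `𝒪_{A,p}`), if `Φ ≡ Φ₀ (mod m)` with `rank Φ₀ ≤ k − 1`, the ideal `J` spanned by
  the `(k+1) × (k+1)` minors of `Φ` (= the ideal of `D_k(φ)` at `p`, by definition) lies in `m²`, so `A ⧸ J`
  (= `𝒪_{D_k(φ),p}`) is not regular as soon as `dim (A ⧸ J) < dim A`.
* §4 `not_isRegularLocalRing_doublePoint` / `not_isRegularLocalRing_minorSpan_doublePoint` — direction / non-vacuity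
  checks: the hypotheses are met by `K⟦X⟧ ⊃ (X²)` (`(X²) = m²`, `dim 0 < 1`), resp. by `Φ = X·1` (`2 × 2`, `Φ₀ = 0`, `k = 1`,
  minors ideal `= (X²)`), and indeed the double point `K⟦X⟧ ⧸ (X²)` is not a regular local ring.

So the local-algebra half of the SHAPE LEMMA (ATTEMPT-6 §1 (ii)) is now kernel-checked end to end; what stays on
paper there is the dictionary «smooth point of a finite-type `ℂ`-scheme = regular local ring», «ideal of `D_k(φ)` =
the `(k+1)`-minors» (definition), the dimension count `dim_p Z ≤ 2n − 1 < 2n = dim 𝒪_{A,p}`, Fulton–Lazarsfeld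
non-emptiness, and Thom–Porteous — as listed in `PorteousShapes.lean`.  USED BY (paper): ATTEMPT-6 §1 (ii) (shapes
`(2,3)/(3,2)` at the rung are singular along `D_{k−1} ≠ ∅`) and ATTEMPT-7 §2 (γ′)(a) (a scheme-smooth `D_{e−1}(φ)` of
dimension `< dim A` has `D_{e−2}(φ) = ∅`, for EVERY `φ`; that the genericity of `φ` typed in THEOREM N″ /
COROLLARY N″₆ (`PorteousConfinement.lean`) enters only through its set-up is the paper use-ledger of ATTEMPT-7 §3 —
seat ×1, same lineage, read invited; until read, COROLLARY N″₆ is quoted with its typed hypothesis «`φ` generic»).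
Nothing here constructs a variety, a degeneracy locus or a Weil class; nothing here says that
HC / HC_CM / HC_AV holds; no Literature fact is declared; NEGATIVE #12's signed text does not move.

References (dictionary only): Matsumura, Commutative Ring Theory, §14 (regular local rings, `emb dim A = dim m/m²`) and
§21 p. 171 AS PRINTED («`A = R/𝔞` with `𝔞 ⊂ 𝔫²` … then we have `𝔪 = 𝔫/𝔞` and `𝔪/𝔪² = 𝔫/(𝔞 + 𝔫²) = 𝔫/𝔫²`, so that
`dim R = n = emb dim A`») — the identity §1 proves; Fulton, Intersection Theory, App. A.6–A.7; ATTEMPT-6.md §1; ATTEMPT-7.md §2–§3.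
-/

namespace Summit.Ventures.HSemireg.PorteousShapes

open IsLocalRing

/-! ## §1 An ideal inside `m²` does not change the minimal number of generators of the maximal ideal -/

section CotangentComparison

variable {R : Type*} [CommRing R] [IsLocalRing R] (I : Ideal R)

/-- The quotient of a local ring by a proper ideal is local (a named instance of `IsLocalRing.of_surjective'`,
recorded so that `maximalIdeal (R ⧸ I)` can be written below). -/
theorem isLocalRing_quotient (hI : I ≠ ⊤) : IsLocalRing (R ⧸ I) :=
  haveI : Nontrivial (R ⧸ I) := Ideal.Quotient.nontrivial_iff.mpr hI
  IsLocalRing.of_surjective' (Ideal.Quotient.mk I) Ideal.Quotient.mk_surjective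

/-- The maximal ideal of `R ⧸ I` is the image of the maximal ideal of `R`. -/
theorem maximalIdeal_quotient_eq_map [IsLocalRing (R ⧸ I)] :
    maximalIdeal (R ⧸ I) = (maximalIdeal R).map (Ideal.Quotient.mk I) :=
  (map_maximalIdeal_of_surjective (Ideal.Quotient.mk I) Ideal.Quotient.mk_surjective).symm

/-- The maximal ideal of `R ⧸ I` pulls back to the maximal ideal of `R`. -/
theorem comap_maximalIdeal_quotient [IsLocalRing (R ⧸ I)] :
    (maximalIdeal (R ⧸ I)).comap (Ideal.Quotient.mk I) = maximalIdeal R := by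
  have hI : I ≠ ⊤ := by
    intro h
    have : Subsingleton (R ⧸ I) := Ideal.Quotient.subsingleton_iff.mpr h
    exact false_of_nontrivial_of_subsingleton (R ⧸ I)
  rw [maximalIdeal_quotient_eq_map I, Ideal.comap_map_of_surjective _ Ideal.Quotient.mk_surjective,
    ← RingHom.ker_eq_comap_bot, Ideal.mk_ker, sup_eq_left]
  exact le_maximalIdeal hI

/-- Generators of `m` map to generators of `m̄`: the maximal ideal of a quotient of a Noetherian local ring needs at
most as many generators as the maximal ideal upstairs. -/
theorem spanFinrank_maximalIdeal_quotient_le [IsNoetherianRing R] [IsLocalRing (R ⧸ I)] :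
    (maximalIdeal (R ⧸ I)).spanFinrank ≤ (maximalIdeal R).spanFinrank := by
  rw [maximalIdeal_quotient_eq_map I]
  exact Ideal.spanFinrank_map_le_of_fg (Ideal.Quotient.mk I) (maximalIdeal R).fg_of_isNoetherianRing

/-- **Nakayama step.**  If `I ≤ m²`, lifts of generators of `m̄ = m/I` already generate `m`: so `m` needs at most as
many generators as `m̄`. -/
theorem spanFinrank_maximalIdeal_le_quotient_of_le_sq [IsNoetherianRing R] [IsLocalRing (R ⧸ I)]
    (hI : I ≤ maximalIdeal R ^ 2) :
    (maximalIdeal R).spanFinrank ≤ (maximalIdeal (R ⧸ I)).spanFinrank := by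
  classical
  -- a generating finset of `m̄` of minimal cardinality
  obtain ⟨s, hscard, hsspan⟩ := Submodule.FG.exists_span_finset_card_eq_spanFinrank
    (maximalIdeal (R ⧸ I)).fg_of_isNoetherianRing
  -- lift it to `R`
  set g : R ⧸ I → R := Function.surjInv (Ideal.Quotient.mk_surjective (I := I)) with hg
  set s' : Finset R := s.image g with hs'
  have himage : (Ideal.Quotient.mk I) '' (s' : Set R) = (s : Set (R ⧸ I)) := by
    rw [hs', Finset.coe_image, ← Set.image_comp, hg, Function.comp_surjInv, Set.image_id]
  have hmap : (Ideal.span (s' : Set R)).map (Ideal.Quotient.mk I) = maximalIdeal (R ⧸ I) := by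
    rw [Ideal.map_span, himage]
    exact hsspan
  -- `m ≤ span s' ⊔ I ≤ span s' ⊔ m • m`
  have hle : maximalIdeal R ≤ Ideal.span (s' : Set R) ⊔ maximalIdeal R • maximalIdeal R := by
    have h1 : maximalIdeal R ≤ Ideal.span (s' : Set R) ⊔ I := by
      have := comap_maximalIdeal_quotient I
      rw [← hmap, Ideal.comap_map_of_surjective _ Ideal.Quotient.mk_surjective, ← RingHom.ker_eq_comap_bot,
        Ideal.mk_ker] at this
      exact this.ge
    refine h1.trans (sup_le_sup_left ?_ _)
    rw [Ideal.smul_eq_mul, ← pow_two]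
    exact hI
  -- Nakayama: `m ≤ span s'`
  have hNak : maximalIdeal R ≤ Ideal.span (s' : Set R) :=
    Submodule.le_of_le_smul_of_le_jacobson_bot (maximalIdeal R).fg_of_isNoetherianRing
      (maximalIdeal_le_jacobson ⊥) hle
  -- and `span s' ≤ m` because the lifts lie in `m`
  have hge : Ideal.span (s' : Set R) ≤ maximalIdeal R := by
    rw [Ideal.span_le]
    intro x hx
    have hx' : Ideal.Quotient.mk I x ∈ maximalIdeal (R ⧸ I) := by
      rw [← hsspan]
      refine Ideal.subset_span ?_
      rw [← himage]
      exact Set.mem_image_of_mem _ hx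
    have := Ideal.mem_comap.mpr hx'
    rwa [comap_maximalIdeal_quotient I] at this
  have heq : maximalIdeal R = Ideal.span (s' : Set R) := le_antisymm hNak hge
  calc (maximalIdeal R).spanFinrank = (Ideal.span (s' : Set R)).spanFinrank := by rw [← heq]
    _ ≤ (s' : Set R).ncard := Submodule.spanFinrank_span_le_ncard_of_finite s'.finite_toSet
    _ = s'.card := Set.ncard_coe_finset s'
    _ ≤ s.card := Finset.card_image_le
    _ = (maximalIdeal (R ⧸ I)).spanFinrank := hscard

/-- **`I ≤ m²` does not change the minimal number of generators of the maximal ideal.** -/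
theorem spanFinrank_maximalIdeal_quotient_eq_of_le_sq [IsNoetherianRing R] [IsLocalRing (R ⧸ I)]
    (hI : I ≤ maximalIdeal R ^ 2) :
    (maximalIdeal (R ⧸ I)).spanFinrank = (maximalIdeal R).spanFinrank :=
  le_antisymm (spanFinrank_maximalIdeal_quotient_le I) (spanFinrank_maximalIdeal_le_quotient_of_le_sq I hI)

/-- **Zariski (co)tangent spaces agree.**  If `I ≤ m²`, the cotangent space `m̄/m̄²` of `R ⧸ I` has the same
dimension (over its residue field) as the cotangent space `m/m²` of `R`: the embedding dimension does not drop. -/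
theorem finrank_cotangentSpace_quotient_eq_of_le_sq [IsNoetherianRing R] [IsLocalRing (R ⧸ I)]
    (hI : I ≤ maximalIdeal R ^ 2) :
    Module.finrank (ResidueField (R ⧸ I)) (CotangentSpace (R ⧸ I)) =
      Module.finrank (ResidueField R) (CotangentSpace R) := by
  rw [← spanFinrank_maximalIdeal_eq_finrank_cotangentSpace, ← spanFinrank_maximalIdeal_eq_finrank_cotangentSpace]
  exact spanFinrank_maximalIdeal_quotient_eq_of_le_sq I hI

end CotangentComparison

/-! ## §2 A quotient by an ideal inside `m²` that lowers the dimension is not a regular local ring -/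

section Regularity

variable {R : Type*} [CommRing R] [IsLocalRing R] [IsNoetherianRing R] (I : Ideal R)

/-- If `I ≤ m²` and `R ⧸ I` is a regular local ring, then `dim R ≤ dim (R ⧸ I)`: indeed
`dim R ≤ μ(m) = μ(m̄) = dim (R ⧸ I)` (Krull's height theorem, §1, and the definition of regularity). -/
theorem ringKrullDim_le_of_isRegularLocalRing_quotient (hI : I ≤ maximalIdeal R ^ 2)
    (hreg : IsRegularLocalRing (R ⧸ I)) : ringKrullDim R ≤ ringKrullDim (R ⧸ I) := by
  calc ringKrullDim R ≤ ((maximalIdeal R).spanFinrank : WithBot ℕ∞) := ringKrullDim_le_spanFinrank_maximalIdeal R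
    _ = ((maximalIdeal (R ⧸ I)).spanFinrank : WithBot ℕ∞) := by
        rw [spanFinrank_maximalIdeal_quotient_eq_of_le_sq I hI]
    _ = ringKrullDim (R ⧸ I) := hreg.spanFinrank_maximalIdeal

/-- **Tangent-space obstruction to regularity.**  If `I ≤ m²` and `dim (R ⧸ I) < dim R`, then `R ⧸ I` is NOT a
regular local ring.  (Geometry: `I_{Z,p} ⊆ m_p²` makes the Zariski tangent space of `Z` at `p` equal to `T_pA`, of
dimension `dim A > dim_p Z`, so `Z` is singular at `p`.) -/
theorem not_isRegularLocalRing_quotient_of_le_sq (hI : I ≤ maximalIdeal R ^ 2)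
    (hdim : ringKrullDim (R ⧸ I) < ringKrullDim R) : ¬ IsRegularLocalRing (R ⧸ I) :=
  fun hreg => not_le_of_gt hdim (ringKrullDim_le_of_isRegularLocalRing_quotient I hI hreg)

end Regularity

/-! ## §3 Composition with §2 of `PorteousShapes.lean`: the local ring of `D_k(φ)` at a point of `D_{k−1}(φ)` -/

section MinorIdeal

variable {K A : Type*} [Field K] [CommRing A] [Algebra K A] [IsLocalRing A]
variable {m n : Type*} [Fintype n]

/-- The ideal spanned by the `(k+1) × (k+1)` minors of `Φ` (row and column selections `Fin (k+1) → _`; this is the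
ideal of `D_k(φ)` at `p` when `A = 𝒪_{A,p}`) lies in `m²` whenever `Φ ≡ Φ₀ (mod m)` with `rank Φ₀ ≤ k − 1`. -/
theorem minorSpan_le_sq (Φ : Matrix m n A) (Φ₀ : Matrix m n K)
    (hΦ : ∀ i j, Φ i j - algebraMap K A (Φ₀ i j) ∈ maximalIdeal A) {k : ℕ} (hrank : Φ₀.rank + 1 ≤ k) :
    Ideal.span (Set.range fun rc : (Fin (k + 1) → m) × (Fin (k + 1) → n) => (Φ.submatrix rc.1 rc.2).det)
      ≤ maximalIdeal A ^ 2 := by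
  rw [Ideal.span_le]
  rintro _ ⟨⟨rows, cols⟩, rfl⟩
  exact minor_succ_det_mem_sq (maximalIdeal A) Φ Φ₀ hΦ hrank rows cols

/-- **`D_k(φ)` is singular at every point of `D_{k−1}(φ)` (local-ring form).**  With `A = 𝒪_{A,p}` a Noetherian local
`K`-algebra, `Φ` the matrix of `φ` near `p`, `Φ₀ = Φ(p)` of rank `≤ k − 1`, and `J` the ideal of the `(k+1)`-minors:
if `dim (A ⧸ J) < dim A` (e.g. `D_k(φ)` an `n`-fold in the `2n`-fold, `n ≥ 1`), then `A ⧸ J = 𝒪_{D_k(φ),p}` is not a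
regular local ring. -/
theorem not_isRegularLocalRing_quotient_minorSpan [IsNoetherianRing A] (Φ : Matrix m n A) (Φ₀ : Matrix m n K)
    (hΦ : ∀ i j, Φ i j - algebraMap K A (Φ₀ i j) ∈ maximalIdeal A) {k : ℕ} (hrank : Φ₀.rank + 1 ≤ k)
    (hdim : ringKrullDim (A ⧸ Ideal.span (Set.range fun rc : (Fin (k + 1) → m) × (Fin (k + 1) → n) =>
        (Φ.submatrix rc.1 rc.2).det)) < ringKrullDim A) :
    ¬ IsRegularLocalRing (A ⧸ Ideal.span (Set.range fun rc : (Fin (k + 1) → m) × (Fin (k + 1) → n) =>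
        (Φ.submatrix rc.1 rc.2).det)) :=
  not_isRegularLocalRing_quotient_of_le_sq _ (minorSpan_le_sq Φ Φ₀ hΦ hrank) hdim

end MinorIdeal

/-! ## §4 Direction / non-vacuity check: the double point `K⟦X⟧ ⧸ (X²)` is not a regular local ring -/

section DoublePoint

open PowerSeries

variable (K : Type*) [Field K]

/-- In `K⟦X⟧` the ideal `(X²)` is the square of the maximal ideal `(X)`. -/
theorem span_X_sq_eq_maximalIdeal_sq : Ideal.span {(X : K⟦X⟧) ^ 2} = maximalIdeal K⟦X⟧ ^ 2 := by
  rw [maximalIdeal_eq_span_X, Ideal.span_singleton_pow]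

/-- `dim K⟦X⟧ ⧸ (X²) < dim K⟦X⟧ (= 1)`: cutting the one-dimensional regular local ring `K⟦X⟧` by the non-zero-divisor
`X²` lowers the Krull dimension. -/
theorem ringKrullDim_doublePoint_lt :
    ringKrullDim (K⟦X⟧ ⧸ Ideal.span {(X : K⟦X⟧) ^ 2}) < ringKrullDim K⟦X⟧ := by
  have hX2 : (X : K⟦X⟧) ^ 2 ∈ nonZeroDivisors K⟦X⟧ :=
    mem_nonZeroDivisors_of_ne_zero (pow_ne_zero 2 X_ne_zero)
  have h1 := ringKrullDim_quotient_succ_le_of_nonZeroDivisor hX2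
  have hdim : ringKrullDim K⟦X⟧ = 1 := IsPrincipalIdealRing.ringKrullDim_eq_one _ PowerSeries.not_isField
  rw [hdim] at h1 ⊢
  by_contra h
  rw [not_lt] at h
  have h2 : (1 : WithBot ℕ∞) + 1 ≤ 1 := (add_le_add h le_rfl).trans h1
  have h3 : ¬ ((1 : WithBot ℕ∞) + 1 ≤ 1) := by decide
  exact h3 h2

/-- **The double point is singular** — an instance of `not_isRegularLocalRing_quotient_of_le_sq` with honest (non-vacuous)
hypotheses: `(X²) ≤ m²` and `dim K⟦X⟧⧸(X²) = 0 < 1`, so `K⟦X⟧ ⧸ (X²)` is not a regular local ring. -/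
theorem not_isRegularLocalRing_doublePoint : ¬ IsRegularLocalRing (K⟦X⟧ ⧸ Ideal.span {(X : K⟦X⟧) ^ 2}) :=
  not_isRegularLocalRing_quotient_of_le_sq _ (span_X_sq_eq_maximalIdeal_sq K).le (ringKrullDim_doublePoint_lt K)

/-- The `2 × 2` minors (all row/column selections `Fin 2 → Fin 2`) of the scalar matrix `X·1` over `K⟦X⟧` span the
ideal `(X²)`: each entry lies in `(X)`, so each `2 × 2` determinant lies in `(X)² = (X²)`, and `det (X·1) = X²`. -/
theorem minorSpan_scalar_X_eq :
    Ideal.span (Set.range fun rc : (Fin 2 → Fin 2) × (Fin 2 → Fin 2) =>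
        (((X : K⟦X⟧) • (1 : Matrix (Fin 2) (Fin 2) K⟦X⟧)).submatrix rc.1 rc.2).det) = Ideal.span {(X : K⟦X⟧) ^ 2} := by
  apply le_antisymm
  · rw [Ideal.span_le]
    rintro _ ⟨⟨rows, cols⟩, rfl⟩
    have hent : ∀ i j, (((X : K⟦X⟧) • (1 : Matrix (Fin 2) (Fin 2) K⟦X⟧)).submatrix rows cols) i j
        ∈ Ideal.span {(X : K⟦X⟧)} := by
      intro i j
      simp only [Matrix.submatrix_apply, Matrix.smul_apply, smul_eq_mul]
      exact Ideal.mul_mem_right _ _ (Ideal.subset_span rfl)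
    have hsq : Ideal.span {(X : K⟦X⟧)} * Ideal.span {(X : K⟦X⟧)} = Ideal.span {(X : K⟦X⟧) ^ 2} := by
      rw [← pow_two, Ideal.span_singleton_pow]
    show ((((X : K⟦X⟧) • (1 : Matrix (Fin 2) (Fin 2) K⟦X⟧)).submatrix rows cols).det) ∈ Ideal.span {(X : K⟦X⟧) ^ 2}
    rw [Matrix.det_fin_two, ← hsq]
    exact Ideal.sub_mem _ (Ideal.mul_mem_mul (hent _ _) (hent _ _)) (Ideal.mul_mem_mul (hent _ _) (hent _ _))
  · rw [Ideal.span_singleton_le_iff_mem]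
    refine Ideal.subset_span ⟨⟨id, id⟩, ?_⟩
    simp [pow_two]

/-- **Non-vacuity of the COMPOSED form** `not_isRegularLocalRing_quotient_minorSpan`: with `A = K⟦X⟧`, `Φ = X·1`
(`2 × 2`), `Φ₀ = 0` (rank `0`, so `k = 1`), every hypothesis is met — `Φ ≡ 0 (mod (X))`, `rank 0 + 1 ≤ 1`, and the ideal of
`2 × 2` minors is `(X²)` with `dim K⟦X⟧⧸(X²) < dim K⟦X⟧` — and the conclusion is the honest one: the double point
(`= D_1` of the matrix `X·1` at the origin, a point of `D_0`) is not a regular local ring. -/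
theorem not_isRegularLocalRing_minorSpan_doublePoint :
    ¬ IsRegularLocalRing (K⟦X⟧ ⧸ Ideal.span (Set.range fun rc : (Fin 2 → Fin 2) × (Fin 2 → Fin 2) =>
        (((X : K⟦X⟧) • (1 : Matrix (Fin 2) (Fin 2) K⟦X⟧)).submatrix rc.1 rc.2).det)) := by
  refine not_isRegularLocalRing_quotient_minorSpan (K := K) ((X : K⟦X⟧) • (1 : Matrix (Fin 2) (Fin 2) K⟦X⟧))
    (0 : Matrix (Fin 2) (Fin 2) K) ?_ (k := 1) (by simp) ?_
  · intro i j
    simp only [Matrix.zero_apply, map_zero, sub_zero, Matrix.smul_apply, smul_eq_mul, maximalIdeal_eq_span_X,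
      Ideal.mem_span_singleton]
    exact dvd_mul_right _ _
  · rw [minorSpan_scalar_X_eq]
    exact ringKrullDim_doublePoint_lt K

end DoublePoint

end Summit.Ventures.HSemireg.PorteousShapes
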